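import Summits.CriticalPhenomena.PercolationContinuityZ3.Theorems.SahiMasterFamilyBernsteinSimplex
import Summits.CriticalPhenomena.PercolationContinuityZ3.Theorems.SahiMasterFamilyUCBernsteinNested

/-!
# Conjecture (B) on the simplex for every finite collection of union-closed families ALL OF WHOSE PARTIAL UNIONS ARE UNION-CLOSED —
# chains `𝒰_1 ⊆ ⋯ ⊆ 𝒰_m` of any length, arbitrary collections of up-sets — every order: the mixture polynomial
# `w ↦ Φ_{n+1}(Σ_x w_x 1_{𝒰_x})` is a nonnegative combination of monomials `∏_x w_x^{e_x}`, `|e| ≤ n+1`, on the simplex `Σ_x w_x = 1`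

Unit `prim-masterthm-p4` (gen 22; crux anchor stmt-CriticalPhenomena-4575, helper work; memo
`run/shared/lean/prim/prim-masterthm/prim-masterthm-p4/P4-GEN22-REPORT.md` §2b).  Multi-family version of `…UCBernsteinNested` (two families with
union-closed union), on top of `…BernsteinSimplex` (`BPosS`, `mixS`) and `…BernsteinPos` (block expansion and cap identity for every real set
function).  Conjecture (B) of `…UCBernstein` (`UCBernsteinNonneg`) asks that for union-closed `𝒰_x ∋ univ` every layer sum `N_j` — the degree-`(n+1)`
Bernstein coefficient of index `j` of the mixture polynomial on the simplex — be `≥ 0`; `BPosS (n+1)` of the mixture functional is that statement in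
polynomial form (a nonnegative combination of monomials of degree `≤ n+1` on the simplex; homogenise with `(Σ_x w_x)^{n+1−|e|} = 1`).

**THEOREM (every order)** `bposS_phiSet_mixS_of_partialUnions`: let `𝒰 : α → Finset (Finset (Fin (n+1)))` (`α` finite) be such that for EVERY
sub-collection `Y ⊆ α` the union `⋃_{x∈Y} 𝒰_x` is union-closed (in particular each `𝒰_x` is; no top condition).  Then
`w ↦ Φ_{n+1}(Σ_x w_x 1_{𝒰_x})` is `BPosS (n+1)`.  Corollaries: `bposS_phiSet_mixS_of_chain` (any finite CHAIN of union-closed families — all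
multi-step chains of the union-closed polytope), `bposS_phiSet_mixS_of_upper` (any finite collection of UP-SETS), `phiSet_mixS_nonneg_of_partialUnions`
(pointwise on the standard simplex; this was known — such mixtures are min-closed, `…PhiMinClosed` — the coefficientwise statement is the new content).

PROOF (memo §2b) — ONE uniform step.  Let `Y = {x : univ ∉ 𝒰_x}`.  Since `⋃_{x∈Y} 𝒰_x` is union-closed and misses `univ`, some index `t` lies in no
member of any `𝒰_x`, `x ∈ Y` (`PhiSegment.exists_forall_notMem`); relabel `t ↦ last` (`BernsteinSimplex.phiSet_mixS_comap_perm`).  For a block `B ∋ last`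
the mixture value is `β_B = Σ_{x∉Y} w_x[B ∈ 𝒰_x]`, so on the simplex `1 − β_B = Σ_{x∈Y} w_x + r_B`, `r_B = Σ_{x∉Y} w_x[B ∉ 𝒰_x]`, `r_univ = 0`.  The block
expansion `Φ = Σ_{B∋last} c_B β_B κ_B` and the cap identity `Σ_B c_B κ_B = W` (`…BernsteinPos`, every real `β`) give
`Φ(β) = (Σ_{x∉Y} w_x)·W(β) + Σ_{B ∋ last, B ≠ univ} c_B·r_B·Φ(β|_{Bᶜ})`, every factor `BPosS` of the right degree (`W`: `≤ n`; the restricted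
functionals: pulled-back collections inherit the hypothesis, strong induction).  No case distinction (`Y = ∅`: the first factor is `Σ_x w_x = 1`;
`Y = α`: everything vanishes).  HONEST FRAMING: a structural all-order theorem; conjecture (B) for general collections (already for two general
families), `UCHullNonneg k` (k ≥ 8), Sahi's `C_k`, Kahn's Conjecture 5 and the master theorem remain OPEN.  Axioms standard. [this work]
-/

noncomputable section

open scoped Classical

namespace Summit.CriticalPhenomena.PercolationContinuityZ3.Theorems

namespace UCBernsteinPartialUnions

open Finset Function Equiv
open Literature.Combinatorics.Sahi2008
open Literature.Combinatorics.Sahi2008.CycleForm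
open PrincipalCapBeta (phiSet realF realW)
open BernsteinPos BernsteinSimplex

variable {α : Type} [Fintype α] {n : ℕ}

/-- The residual linear form `r_B(w) = Σ_{x ∉ Y} w_x [B ∉ 𝒰_x]` is `BPosS 1`. [this work] -/
theorem bposS_resid (𝒰 : α → Finset (Finset (Fin n))) (Y : Finset α) (B : Finset (Fin n)) :
    BPosS 1 (fun w : α → ℝ => ∑ x ∈ univ.filter (fun x => x ∉ Y), w x * (1 - (if B ∈ 𝒰 x then (1 : ℝ) else 0))) := by
  refine BPosS.sum _ (fun x w => w x * (1 - (if B ∈ 𝒰 x then (1 : ℝ) else 0))) fun x _ => ?_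
  by_cases h : B ∈ 𝒰 x
  · exact bposS_zero.congr fun w _ => by rw [if_pos h]; ring
  · exact (bposS_coord x).congr fun w _ => by rw [if_neg h]; ring

omit [Fintype α] in
/-- Pull-backs inherit the partial-union hypothesis. [this work] -/
theorem partialUnions_comap {m : ℕ} (e : Fin m ↪ Fin n) (𝒰 : α → Finset (Finset (Fin n)))
    (hPU : ∀ Y : Finset α, ∀ A ∈ Y.biUnion 𝒰, ∀ B ∈ Y.biUnion 𝒰, A ∪ B ∈ Y.biUnion 𝒰) :
    ∀ Y : Finset α, ∀ A ∈ Y.biUnion (fun x => comap e (𝒰 x)), ∀ B ∈ Y.biUnion (fun x => comap e (𝒰 x)),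
      A ∪ B ∈ Y.biUnion (fun x => comap e (𝒰 x)) := by
  intro Y
  rw [← comap_biUnion]
  exact comap_unionClosed e _ (hPU Y)

/-- **Root-last step (uniform).**  Assume the theorem below order `n+1`; let `Y` be the set of labels whose family misses `univ`, and suppose the
last index lies in no member of `𝒰_x`, `x ∈ Y`.  Then the mixture functional is `BPosS (n+1)`. [this work] -/
theorem bposS_mixS_rootLast (n : ℕ)
    (ih : ∀ m < n, ∀ (𝒰 : α → Finset (Finset (Fin (m + 1)))),
      (∀ Y : Finset α, ∀ A ∈ Y.biUnion 𝒰, ∀ B ∈ Y.biUnion 𝒰, A ∪ B ∈ Y.biUnion 𝒰) →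
      BPosS (m + 1) (fun w => phiSet (m + 1) (mixS 𝒰 w)))
    (𝒰 : α → Finset (Finset (Fin (n + 1))))
    (hPU : ∀ Y : Finset α, ∀ A ∈ Y.biUnion 𝒰, ∀ B ∈ Y.biUnion 𝒰, A ∪ B ∈ Y.biUnion 𝒰)
    (Y : Finset α) (hY : ∀ x, x ∉ Y → univ ∈ 𝒰 x) (havoid : ∀ x ∈ Y, ∀ S ∈ 𝒰 x, Fin.last n ∉ S) :
    BPosS (n + 1) (fun w => phiSet (n + 1) (mixS 𝒰 w)) := by
  -- restricted functionals, one order down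
  have hsub : ∀ B : Finset (Fin (n + 1)), Fin.last n ∈ B → B ≠ univ →
      BPosS n (fun w : α → ℝ => -coRest (realW (mixS 𝒰 w)) realF B) := by
    intro B hB hBu
    obtain ⟨m, e, he, hc⟩ := exists_emb_coRest hBu
    have hm : m < n := PhiVertex.lt_of_emb_ne_last e fun j hj => he j (by rw [hj]; exact hB)
    have ihB := ih m hm (fun x => comap e (𝒰 x)) (partialUnions_comap e 𝒰 hPU)
    refine (ihB.mono (by omega)).congr fun w _ => ?_
    rw [hc, mixS_map, neg_neg]
  -- the pieces
  have hW := bposS_W (k := n) 𝒰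
  have hcY := bposS_sum_coord (α := α) (univ.filter fun x => x ∉ Y)
  have hterms : BPosS (n + 1) (fun w : α → ℝ => ∑ B ∈ univ.filter (fun B : Finset (Fin (n + 1)) => Fin.last n ∈ B),
      ((B.card - 1).factorial : ℝ) * ((∑ x ∈ univ.filter (fun x => x ∉ Y), w x * (1 - (if B ∈ 𝒰 x then (1 : ℝ) else 0))) *
        (-coRest (realW (mixS 𝒰 w)) realF B))) := by
    refine BPosS.sum _ (fun B w => ((B.card - 1).factorial : ℝ) *
      ((∑ x ∈ univ.filter (fun x => x ∉ Y), w x * (1 - (if B ∈ 𝒰 x then (1 : ℝ) else 0))) *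
        (-coRest (realW (mixS 𝒰 w)) realF B))) fun B hB => ?_
    have hlB : Fin.last n ∈ B := (mem_filter.1 hB).2
    by_cases hBu : B = univ
    · refine bposS_zero.congr fun w _ => ?_
      have h0 : ∑ x ∈ univ.filter (fun x => x ∉ Y), w x * (1 - (if B ∈ 𝒰 x then (1 : ℝ) else 0)) = 0 := by
        refine sum_eq_zero fun x hx => ?_
        rw [hBu, if_pos (hY x (mem_filter.1 hx).2)]; ring
      rw [h0]; ring
    · exact (((bposS_resid 𝒰 Y B).mul (hsub B hlB hBu)).smul (Nat.cast_nonneg _)).mono (by omega)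
  refine (((hcY.mul hW).mono (by omega)).add hterms).congr fun w hw => ?_
  -- the identity on the simplex
  have hβ : ∀ B : Finset (Fin (n + 1)), Fin.last n ∈ B →
      mixS 𝒰 w B = (∑ x ∈ univ.filter (fun x => x ∉ Y), w x) -
        ∑ x ∈ univ.filter (fun x => x ∉ Y), w x * (1 - (if B ∈ 𝒰 x then (1 : ℝ) else 0)) := by
    intro B hB
    unfold mixS
    rw [← Finset.sum_filter_add_sum_filter_not univ (fun x => x ∈ Y)]
    have h0 : ∑ x ∈ univ.filter (fun x => x ∈ Y), w x * (if B ∈ 𝒰 x then (1 : ℝ) else 0) = 0 := by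
      refine sum_eq_zero fun x hx => ?_
      rw [if_neg (fun hBx => havoid x (mem_filter.1 hx).2 B hBx hB), mul_zero]
    rw [h0, zero_add, ← sum_sub_distrib]
    exact sum_congr rfl fun x _ => by ring
  show _ = phiSet (n + 1) (mixS 𝒰 w)
  rw [phiSet_eq_sum_blocks_last (mixS 𝒰 w), ← sum_blocks_coRest_eq_W (mixS 𝒰 w), mul_sum, ← sum_add_distrib]
  refine sum_congr rfl fun B hB => ?_
  rw [hβ B (mem_filter.1 hB).2]
  ring

/-- **THEOREM ((B) on the simplex for collections with union-closed partial unions, every order).** [this work] -/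
theorem bposS_phiSet_mixS_of_partialUnions : ∀ (n : ℕ) (𝒰 : α → Finset (Finset (Fin (n + 1)))),
    (∀ Y : Finset α, ∀ A ∈ Y.biUnion 𝒰, ∀ B ∈ Y.biUnion 𝒰, A ∪ B ∈ Y.biUnion 𝒰) →
      BPosS (n + 1) (fun w => phiSet (n + 1) (mixS 𝒰 w)) := by
  intro n
  induction n using Nat.strong_induction_on with
  | _ n ih =>
  intro 𝒰 hPU
  set Y : Finset α := univ.filter fun x => univ ∉ 𝒰 x with hYdef
  have hY : ∀ x, x ∉ Y → univ ∈ 𝒰 x := fun x hx => by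
    by_contra h; exact hx (mem_filter.2 ⟨mem_univ _, h⟩)
  have htopY : univ ∉ Y.biUnion 𝒰 := fun h => by
    obtain ⟨x, hx, hux⟩ := mem_biUnion.1 h
    exact (mem_filter.1 hx).2 hux
  obtain ⟨t, ht⟩ := PhiSegment.exists_forall_notMem (Y.biUnion 𝒰) (hPU Y) htopY
  let σ : Perm (Fin (n + 1)) := Equiv.swap t (Fin.last n)
  have hY' : ∀ x, x ∉ Y → univ ∈ comap σ.toEmbedding (𝒰 x) := fun x hx => by
    rw [mem_comap, Finset.map_univ_equiv]; exact hY x hx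
  have havoid : ∀ x ∈ Y, ∀ S ∈ comap σ.toEmbedding (𝒰 x), Fin.last n ∉ S := fun x hx =>
    UCBernsteinNested.last_notMem_of_comap_swap t (𝒰 x) fun S hS => ht S (mem_biUnion.2 ⟨x, hx, hS⟩)
  have h := bposS_mixS_rootLast n ih (fun x => comap σ.toEmbedding (𝒰 x)) (partialUnions_comap _ 𝒰 hPU) Y hY' havoid
  exact h.congr fun w _ => phiSet_mixS_comap_perm σ 𝒰 w

/-! ### Corollaries: chains, up-sets, pointwise positivity -/

/-- **(B) on every chain of union-closed families** (`𝒰_x ⊆ 𝒰_y` or `𝒰_y ⊆ 𝒰_x` for all labels; no top condition), every order. [this work] -/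
theorem bposS_phiSet_mixS_of_chain (𝒰 : α → Finset (Finset (Fin (n + 1))))
    (hUC : ∀ x, ∀ A ∈ 𝒰 x, ∀ B ∈ 𝒰 x, A ∪ B ∈ 𝒰 x) (hchain : ∀ x y, 𝒰 x ⊆ 𝒰 y ∨ 𝒰 y ⊆ 𝒰 x) :
    BPosS (n + 1) (fun w => phiSet (n + 1) (mixS 𝒰 w)) := by
  refine bposS_phiSet_mixS_of_partialUnions n 𝒰 fun Y A hA B hB => ?_
  obtain ⟨x, hx, hAx⟩ := mem_biUnion.1 hA
  obtain ⟨y, hy, hBy⟩ := mem_biUnion.1 hB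
  rcases hchain x y with h | h
  · exact mem_biUnion.2 ⟨y, hy, hUC y _ (h hAx) _ hBy⟩
  · exact mem_biUnion.2 ⟨x, hx, hUC x _ hAx _ (h hBy)⟩

/-- **(B) for every finite collection of up-sets**, every order. [this work] -/
theorem bposS_phiSet_mixS_of_upper (𝒰 : α → Finset (Finset (Fin (n + 1))))
    (hup : ∀ x, ∀ A ∈ 𝒰 x, ∀ B : Finset (Fin (n + 1)), A ⊆ B → B ∈ 𝒰 x) :
    BPosS (n + 1) (fun w => phiSet (n + 1) (mixS 𝒰 w)) := by
  refine bposS_phiSet_mixS_of_partialUnions n 𝒰 fun Y A hA B _ => ?_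
  obtain ⟨x, hx, hAx⟩ := mem_biUnion.1 hA
  exact mem_biUnion.2 ⟨x, hx, hup x A hAx _ subset_union_left⟩

/-- Pointwise: `Φ_{n+1}(Σ_x w_x 1_{𝒰_x}) ≥ 0` on the standard simplex for collections with union-closed partial unions (a second proof of the
min-closed case `…PhiMinClosed` for these mixtures), every order. [this work] -/
theorem phiSet_mixS_nonneg_of_partialUnions (𝒰 : α → Finset (Finset (Fin (n + 1))))
    (hPU : ∀ Y : Finset α, ∀ A ∈ Y.biUnion 𝒰, ∀ B ∈ Y.biUnion 𝒰, A ∪ B ∈ Y.biUnion 𝒰)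
    {w : α → ℝ} (hw0 : ∀ x, 0 ≤ w x) (hw1 : ∑ x, w x = 1) : 0 ≤ phiSet (n + 1) (mixS 𝒰 w) :=
  (bposS_phiSet_mixS_of_partialUnions n 𝒰 hPU).nonneg hw0 hw1

end UCBernsteinPartialUnions

end Summit.CriticalPhenomena.PercolationContinuityZ3.Theorems
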